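import Summits.QuantumAdvantage.QuantumAdvantage.Statement
import Literature.Computability.Complexity.AlmostPProofs
import Literature.Computability.Complexity.BPPSubsetAlmostP
import Literature.Computability.Cryptography.ClassBQP
import HarnessLib

/-!
# The measure-one (random-oracle) rung of `QuantumAdvantage`

`QuantumAdvantage` is `∃ L, L ∈ BQP ∧ L ∉ BPP`. Over the tree's *discharged* Bennett–Gill
theorem `ALMOST-P = BPP` (`almostP_subset_BPP_holds`, `BPP_subset_almostP_holds`; ALMOST-P =
the languages in `P^A` for almost every oracle `A` under the fair-coin measure
`randomOracleMeasure`) and the oracle-independence of oracle-free quantum circuit families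
(`BQP_subset_BQPRel`), this file records, sorry-free:

* `soloBlind_quantumAdvantage_iff_not_BQP_subset_almostP` — the summit is *literally equivalent*
  to `¬ BQP ⊆ ALMOST-P`: some `BQP` language fails to be polynomial-time relative to a
  positive-measure set of oracles;
* `soloBlind_measureOne_rung` — the summit implies that `BQP^A ⊆ P^A` does **not** hold for
  almost every oracle `A`. This is the contrapositive of Fortnow–Rogers 1999, Thm. 4.4 ("If
  `P = BQP` relative to a random oracle then `BQP = BPP`"), whose printed proof is exactly the
  Bennett–Gill step used here;
* `soloBlind_measureOne_witness` — witness form: a single oracle-free `L ∈ BQP` lying in every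
  `BQP^A` and outside ALMOST-P;
* `soloBlind_measureOne_rung_BPPRel_of` — the same with `BPP^A` in place of `P^A`, conditional on
  the (here hypothesised, not asserted) ALMOST-BPP ⊆ BPP inclusion.

Reading. The random-oracle statement `M1⁻ := ¬ (∀ᵐ A, BQP^A ⊆ P^A)` is a *consequence* of the
summit, hence a rung below it; whether `P^A ≠ BQP^A` for a random `A` is itself open (raised by
Fortnow–Rogers 1998/1999, §5; Aaronson–Ambainis 2014, §1.1 and Thm. 3.5/3.8 explain why a proof is
not expected from current technique: under their Conjecture 1.7 and `P = P^#P`, `BQP^A ⊂ AvgP^A`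
with probability 1). Nothing here is progress towards the summit; it is the kernel-checked form of
one more rung of the analogue atlas, and of the fact that the measure-one analogue, unlike the
single-oracle analogue (which fails at a `PSPACE`-complete oracle), is implied by the summit.

References: C. H. Bennett, J. Gill, *Relative to a random oracle `A`, `P^A ≠ NP^A ≠ co-NP^A` with
probability 1*, SIAM J. Comput. 10 (1981) 96–113, Thm. 5 / §1 (ALMOST-P = BPP); R. V. Book,
H. Vollmer, K. W. Wagner, *On type-2 probabilistic quantifiers*, ICALP 1996, §1, §4 (1);
L. Fortnow, J. Rogers, *Complexity limitations on quantum computation*, J. Comput. System Sci. 59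
(1999) 240–252, Thm. 4.4 and §5 (arXiv:cs/9811023, pp. 7–8); S. Aaronson, A. Ambainis, *The need
for structure in quantum speedups*, Theory of Computing 10 (2014) 133–166, §1.1, Thm. 3.5, Thm. 3.8;
T. Yamakawa, M. Zhandry, *Verifiable quantum advantage without structure*, FOCS 2022
(arXiv:2204.02063), §1.
-/

namespace Summit.QuantumAdvantage.QuantumAdvantage.Theorems

open MeasureTheory Literature.Computability.Complexity Literature.Computability.Complexity.Classes
  Literature.Computability.Cryptography Literature.Computability.QuantumComplexity

/-- Bennett–Gill in the tree: `ALMOST-P = BPP` (both inclusions are discharged theorems). -/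
theorem soloBlind_almostP_eq_BPP : almostP = BPP :=
  almostP_eq_BPP_of almostP_subset_BPP_holds BPP_subset_almostP_holds

/-- The summit is literally `¬ BQP ⊆ ALMOST-P`: some `BQP` language is outside `P^A` for a
positive-measure set of oracles `A` (Bennett–Gill `ALMOST-P = BPP`, both directions). -/
theorem soloBlind_quantumAdvantage_iff_not_BQP_subset_almostP :
    _root_.QuantumAdvantage ↔ ¬ (BQP ⊆ almostP) := by
  rw [soloBlind_almostP_eq_BPP]
  show (∃ L : Language Bool, L ∈ BQP ∧ L ∉ BPP) ↔ ¬ (BQP ⊆ BPP)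
  constructor
  · rintro ⟨L, hL, hL'⟩ hsub
    exact hL' (hsub hL)
  · intro h
    by_contra h'
    exact h fun L hL => by
      by_contra hLB
      exact h' ⟨L, hL, hLB⟩

/-- **Measure-one rung** (Fortnow–Rogers 1999, Thm. 4.4, contrapositive): if `BQP ≠ BPP` then it
is *not* the case that `BQP^A ⊆ P^A` for almost every oracle `A` (fair-coin random oracle,
classical access `Oracle.ofLanguage A` on the `P` side). Proof: an oracle-free witness
`L ∈ BQP ∖ BPP` lies in every `BQP^A`; a.e. inclusion would put it in ALMOST-P `= BPP`. -/
theorem soloBlind_measureOne_rung (h : _root_.QuantumAdvantage) :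
    ¬ (∀ᵐ (A : Set (List Bool)) ∂randomOracleMeasure, BQPRel A ⊆ PRel (Oracle.ofLanguage A)) := by
  obtain ⟨L, hL, hL'⟩ := (id h : ∃ L : Language Bool, L ∈ BQP ∧ L ∉ BPP)
  intro hae
  apply hL'
  apply almostP_subset_BPP_holds
  rw [mem_almostP_iff]
  exact hae.mono fun A hA => hA (BQP_subset_BQPRel A hL)

/-- Witness form of the rung: under the summit one fixed oracle-free language `L ∈ BQP` lies in
`BQP^A` for *every* oracle `A` and is outside ALMOST-P, i.e. `{A | L ∈ P^A}` is not of full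
measure. -/
theorem soloBlind_measureOne_witness (h : _root_.QuantumAdvantage) :
    ∃ L : Language Bool, L ∈ BQP ∧ (∀ A : Language Bool, L ∈ BQPRel A) ∧ L ∉ almostP := by
  obtain ⟨L, hL, hL'⟩ := (id h : ∃ L : Language Bool, L ∈ BQP ∧ L ∉ BPP)
  refine ⟨L, hL, fun A => BQP_subset_BQPRel A hL, fun hA => hL' ?_⟩
  exact almostP_subset_BPP_holds hA

/-- Converse bookkeeping: a `BQP` language outside ALMOST-P *is* a summit witness (the other
Bennett–Gill inclusion `BPP ⊆ ALMOST-P`). So the rung `¬ BQP ⊆ ALMOST-P` is not merely implied by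
the summit but equal to it; what is strictly weaker is the oracle-dependent form
`¬ ∀ᵐ A, BQP^A ⊆ P^A` of `soloBlind_measureOne_rung`, whose witnesses may depend on `A`. -/
theorem soloBlind_quantumAdvantage_of_not_mem_almostP {L : Language Bool} (hL : L ∈ BQP)
    (hL' : L ∉ almostP) : _root_.QuantumAdvantage :=
  show ∃ L : Language Bool, L ∈ BQP ∧ L ∉ BPP from
    ⟨L, hL, fun hB => hL' (BPP_subset_almostP_holds hB)⟩

/-- The `BPP^A` form of the rung, conditional on the ALMOST-BPP half of Bennett–Gill (stated here
as an explicit hypothesis `hBG`, not asserted): under the summit, `BQP^A ⊆ BPP^A` does not hold for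
almost every oracle `A`. -/
theorem soloBlind_measureOne_rung_BPPRel_of
    (hBG : ∀ L : Language Bool,
      (∀ᵐ (A : Set (List Bool)) ∂randomOracleMeasure, L ∈ BPPRel (Oracle.ofLanguage A)) → L ∈ BPP)
    (h : _root_.QuantumAdvantage) :
    ¬ (∀ᵐ (A : Set (List Bool)) ∂randomOracleMeasure,
        BQPRel A ⊆ BPPRel (Oracle.ofLanguage A)) := by
  obtain ⟨L, hL, hL'⟩ := (id h : ∃ L : Language Bool, L ∈ BQP ∧ L ∉ BPP)
  intro hae
  exact hL' (hBG L (hae.mono fun A hA => hA (BQP_subset_BQPRel A hL)))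

end Summit.QuantumAdvantage.QuantumAdvantage.Theorems
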